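import Literature.MathematicalPhysics.QuantumFieldTheory.Balaban1983to89.B8Eq1113Concrete
import Literature.MathematicalPhysics.QuantumFieldTheory.Balaban1983to89.B8Eq1117Analytic
import Literature.MathematicalPhysics.QuantumFieldTheory.Balaban1983to89.B8Claim97OntoProof

/-!
# `Balaban1983to89.B8Eq1119LambdaSpace` — B8 Sect. E pp. 95–97 [Balaban1985RegularSpaces]: the set (1.119) as a
# Banach ball, and the abstract Sect. E theorems (∃! of (1.117), `D′`, the p. 97 ONTO sentence, Lipschitz / analytic
# dependence) ON THE CONCRETE LATTICE REMAINDER `C′ = C′_j(u₁, ·)`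

statement-level skeleton of published theorems with citation tags; proofs where landed; nothing here is a claim
about the Yang–Mills mass gap

CITATION HEADER (lean-in-tree rule 2026-08-18; mega-formalization `lit-balaban`, HOME
`run/shared/lean/pub/lit-balaban/`, reader/typer seat `lit-balaban-r05` gen 9 — SKELETON rows `B8.Eq1.113`
((1.113)–(1.118)), `B8.Claim@97` (the p. 97 onto sentence), `B8.Eq1.125` of `HOME/lit-balaban-r05/ROWS-B8.md`;
interface rows E-B8-14 / E-B8-18 / I-B8-4 of `HOME/lit-balaban-r05/INTERFACES-B8.md`; TAKING line `HOME/STATUS.md`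
2026-08-21T10:15Z).  T. Bałaban, *Spaces of regular gauge field configurations on a lattice and gauge fixing
conditions*, Commun. Math. Phys. **99** (1985) 75–102 `[Balaban1985RegularSpaces]` ("B8"); [3] = T. Bałaban,
*Averaging operations for lattice gauge theories*, Commun. Math. Phys. **98** (1985) 17–51 `[Balaban1985Averaging]`.
PDF held: `paper:balaban1985-cmp99-regular-spaces-gauge-fixing` (journal page = PDF page + 74); pp. 95–97
[PDF 21–23] read (text layer `p0021.txt`–`p0023.txt`, this unit 2026-08-21).  v1.1 (r05 gen 24,
literature-prover-lit-balaban-r05-g24-0): DOCSTRING-ONLY — the cite-tag page numeral of (1.92) corrected after r12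
gen 14 CITELOC-SWEEP §8 / r05 QUOTE-AUDIT-B8 §3: (1.91) and (1.92) are both on p. 91 [PDF 17] (text layer `p0017.txt`
L31/L34; v1.0 wrote «p.92» resp. «pp.91–92»), and one pair of guillemets around INTERFACES-B8's own words replaced by
plain quotation marks (guillemets in this file = verbatim print only); declarations byte-identical with v1.0 (p260196).

THE PRINTED TEXT (p. 96 [PDF 22]) «Let us assume that |λ| < ½α₄, |Dλ| < ½α₄(L^jη)⁻¹ on Ω_j, |X| < α₄/(2B′₀).
(1.119)  This implies |λ − H′X| < α₄, |D(λ − H′X)| < α₄(L^jη)⁻¹ on Ω_j, (1.120) and by the inequality (214) we have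
|C′(λ − H′X)| < C′₂(α₃ + α₄)α₄, (1.121)»; (p. 97 [PDF 23]) «Taking r = (2max{|λ₀|, |Dλ₀|})⁻¹α₄, we get the
estimate … (1.125) … Thus by the contraction mapping theorem there exists exactly one solution of Eq. (1.117). This
solution is an analytic function of λ defined on the set of λ satisfying (1.119). We take D′(λ) equal to this
solution. … They imply in particular that the mapping (1.113) transforms the set {λ: |λ| < ½α₄, |Dλ| <
½α₄(L^jη)⁻¹ on Ω_j} onto a set containing {λ′: |λ′| < ¼α₄, |Dλ′| < ¼α₄(L^jη)⁻¹ on Ω_j} for α₃, α₄ sufficiently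
small.»

WHAT THIS FILE DOES (knitting, no new mathematics).  The cell has Sect. E twice: ABSTRACTLY over Banach spaces
(r05: `B8SectEStatements` — ∃! of (1.117), `Dprime`, (1.114); `B8Claim97OntoProof` — `Dprime_lipschitz`, the p. 97
onto sentence `linMap_onto_quarter`; `B8Eq1117Analytic` — «analytic function of λ») and CONCRETELY for the lattice
remainder `C′ = C′_j(u₁, ·)` of (213) [3] (p05: `B8Eq1123Concrete`, `B8Ineq125Concrete`, `B8Eq1122Concrete`,
`B8Eq1117Concrete`, `B8Eq1113Concrete` — λ's as plain functions `ℤᵈ → 𝔸` with the SITEWISE members of (1.119), `H′`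
abstract).  Here the two are joined:
* §1 `lamSub U₀ w` — **the set (1.119) as a ball**: the λ-carrier packaged as the CLOSED GRAPH SUBSPACE
  `{(λ, w·D_{U₀}λ)}` of the sup-normed bounded functions on `ℤᵈ ⊕ (ℤᵈ × {directions})` (`w = L^k`, the one-level
  weight of p05's files), a complex Banach space whose norm is print's modulus `max{|λ|, L^k|Dλ|}` (the `r` of
  (1.125)); `isClosed_lamSub`, `instCompleteSpaceLamSub`.
* §2 `lamOf` / `mkLam` (reading a λ off / writing a bounded λ into the space), the sitewise members of (1.119) from
  the norm (`norm_lamOf_le`, `norm_cjDiff_lamOf_le`), and **`Hc`** = p05's abstract `H′` as a CONTINUOUS linear map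
  into the λ-space with **`‖H′‖ ≤ B′₀`** (`norm_Hc_le`) — the form (1.92) has in the abstract files.
* §3 for `C′ := CnlF ∘ lamOf` (`Cc`): `eq1117_iff_fpMap` ((1.117) on the λ-space = p05's (1.118) fixed-point
  equation); the abstract hypotheses VERIFIED from p05's theorems — `h121_concrete` ((1.121) in the X-norm on the ball
  `‖μ‖ < α₄`, from `norm_Cnl_le_of207` = (214)) and `h125_concrete` ((1.125) on the same ball with constant
  `2·(2C2p)(α₃ + α₄)`, from `lipschitz1122` at `2α₄`, modulus `m = ‖μ₁ − μ₂‖`); then the INSTANTIATED theorems: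
  **`eq1117_existsUnique_lamSub`**, **`Dprime_lamSub_eq_concrete`** (the abstract `Dprime` = p05's concrete `Dprime`
  at the λ-component, by «exactly one solution»), **`onto_concrete`** / `onto_concrete_sitewise` — THE p. 97 ONTO
  SENTENCE FOR THE CONCRETE `C′` AND p05's `D′` (INTERFACES-B8 I-B8-4 listed "a concrete-carrier onto sentence" as not
  in the tree), **`Dprime_concrete_lipschitz`**, and `Dprime_concrete_analyticAt_of_analytic` («analytic function of
  λ» for the concrete `D′`, CONDITIONAL on the Banach-analyticity of `C′` on the λ-space — hypothesis `hA`).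
READINGS / HONEST SCOPE.  (a) Exactly p05's setting (READINGS (a)–(d) of `B8Eq1117Concrete`: one-level (207) domain,
all levels `j ≤ k` and all sites, `H′` abstract with the (1.92)/(1.120)-type bounds, `C′₂ := 2·C2p d` in the
smallness, `≤`/closed balls); the onto sentence and the Lipschitz bound need the halved smallness
`α₃ + α₄ ≤ 1/(8B′₀·(2C2p d))` of `B8Claim97OntoProof` (print: «for α₃, α₄ sufficiently small»).  (b) The norm-ball
`‖λ‖ < ½α₄` is print's set (1.119) read with `sup` (it implies the sitewise strict bounds of p05's files and is implied
by sitewise bounds `≤ a < ½α₄`).  (c) (208)'s analyticity of `C′` as a map of Banach spaces is NOT proved in the tree;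
the last theorem keeps it as a hypothesis.  (d) The lattice `H′` of (1.91) stays interface I-B8-2.
DECLARATIONS: definitions with bodies `PairIdx`, `PSpace` (abbrevs), `lamSub`, `lamOf`, `pairFun`, `mkLam`, `Hc`,
`Cc`, one instance; the rest theorems; no `… : Prop` fact is introduced.  REUSED BY NAME: r05 `B8SectEStatements.
{Eq1117, Dprime, eq1117_existsUnique, Dprime_unique}`, `B8Claim97OntoProof.{linMap_onto_quarter', Dprime_lipschitz,
smallness_quarter_of_eighth}`, `B8Eq1117Analytic.Dprime_analyticAt`; p05 `B8Eq1117Concrete.{XSpace, CnlF,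
CnlF_apply, fpMap, norm_Cnl_le_of207}`, `B8Eq1113Concrete.{Dprime, Dprime_spec}`, `B8Eq1122Concrete.lipschitz1122`,
`B8Eq1123Concrete.Cnl`, `B8Ineq125Concrete.C2p`; B7 vocabulary `B7Eq170Flat.cj`, `B7Prop2Explicit.{AvgClosed, pdev,
C0, c2'}`, `B7Eq167Flat.InLambda`, `B7Prop10General.{C6, C7, C4G}`.
Unit `lit-balaban-r05` (gen 9), 2026-08-21.  Nothing here is new mathematics.
-/

noncomputable section

open NormedSpace Finset Metric Set
open scoped BoundedContinuousFunction

namespace Literature.MathematicalPhysics.QuantumFieldTheory.Balaban1983to89.B8Eq1119LambdaSpace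

open B7Prop1Explicit B7Prop2Explicit MatrixLog B7Eq167Flat B7Prop9Flat B7Prop10General
open B7Prop10Flat (one_le_C5 C4'_nonneg C5'_nonneg)
open B7Eq170Flat (cj cj_add cj_apply)
open B8Ineq125Concrete (C2p C2p_nonneg)
open B8Eq1122Concrete (lipschitz1122 cjDiff_sub)
open B8Eq1117Concrete (XSpace CnlF CnlF_apply fpMap norm_Cnl_le_of207 dom120_of_119)

-- `Site` alone would resolve to the torus sites of `Setup.lean`; re-export the `ℤ^d` sites of `B7Prop1Explicit`.
export B7Prop1Explicit (Site)

variable {d : ℕ}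

/-! ## §1 The set (1.119) as a ball: the Banach space `Λ` of the λ's with print's modulus `max{|λ|, L^jη|Dλ|}` -/

section Space

variable {𝔸 : Type*} [NormedRing 𝔸] [NormedAlgebra ℂ 𝔸]

variable (d) in
/-- The index set `ℤᵈ ⊕ (ℤᵈ × {directions})` carrying a λ (sites) and its covariant differences `D_{U₀}λ` (bonds).
[cite: Balaban1985RegularSpaces, (1.119) p.96 (the two members |λ| and |Dλ|)] -/
abbrev PairIdx : Type := Site d ⊕ (Site d × Fin d)

variable (d) in
/-- The ambient Banach space: bounded `𝔸`-valued functions on `PairIdx d` with the sup norm.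
[cite: Balaban1985RegularSpaces, (1.119) p.96] -/
abbrev PSpace (𝔸 : Type*) [NormedRing 𝔸] : Type _ := BoundedContinuousFunction (PairIdx d) 𝔸

/-- Conjugation by a unit commutes with complex scalars. [folklore] -/
private theorem cj_smulC (w : 𝔸ˣ) (c : ℂ) (X : 𝔸) : cj w (c • X) = c • cj w X := by
  simp only [cj_apply, mul_smul_comm, smul_mul_assoc]

omit [NormedAlgebra ℂ 𝔸] in
/-- Conjugation by a unit kills `0`. [folklore] -/
private theorem cj_zero (w : 𝔸ˣ) : cj w (0 : 𝔸) = 0 := by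
  simp [cj_apply]

/-- **The λ-space of (1.119)** for a background `U₀` and a weight `w` (print: `w = (L^jη)`… here the one-level weight
`w = L^k` of p05's concrete Sect. E files): the CLOSED GRAPH SUBSPACE of the sup-normed bounded functions on
`ℤᵈ ⊕ (ℤᵈ × {directions})` consisting of the pairs `(λ, w·D_{U₀}λ)`, `(D_{U₀}λ)(x, κ) = R(U₀(x,κ))λ(x + e_κ) − λ(x)`;
its norm is print's modulus `max{|λ|, w|Dλ|}`, so the sets (1.119)/(1.120) «|λ| < ½α₄, |Dλ| < ½α₄(L^jη)⁻¹» /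
«|λ − H′X| < α₄, |D(λ − H′X)| < α₄(L^jη)⁻¹» are the norm balls of radii `½α₄` / `α₄`.
[cite: Balaban1985RegularSpaces, (1.119)–(1.120) p.96; (1.125) p.97 («max{|λ₀|, |Dλ₀|}»)] -/
def lamSub (U₀ : Site d → Fin d → 𝔸ˣ) (w : ℝ) : Submodule ℂ (PSpace d 𝔸) where
  carrier := {s | ∀ (x : Site d) (κ : Fin d),
    s (Sum.inr (x, κ)) = (w : ℂ) • (cj (U₀ x κ) (s (Sum.inl (x + e κ))) - s (Sum.inl x))}
  add_mem' := by
    intro s t hs ht x κ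
    simp only [Set.mem_setOf_eq] at hs ht
    simp only [BoundedContinuousFunction.coe_add, Pi.add_apply, hs x κ, ht x κ, cj_add, smul_sub, smul_add]
    abel
  zero_mem' := by
    intro x κ
    simp [cj_zero]
  smul_mem' := by
    intro c s hs x κ
    simp only [Set.mem_setOf_eq] at hs
    simp only [BoundedContinuousFunction.coe_smul, hs x κ, cj_smulC, smul_sub]
    rw [smul_comm c (w : ℂ), smul_comm c (w : ℂ)]

/-- Membership in the λ-space, unfolded. [cite: Balaban1985RegularSpaces, (1.119) p.96] -/
theorem mem_lamSub {U₀ : Site d → Fin d → 𝔸ˣ} {w : ℝ} {s : PSpace d 𝔸} :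
    s ∈ lamSub U₀ w ↔ ∀ (x : Site d) (κ : Fin d),
      s (Sum.inr (x, κ)) = (w : ℂ) • (cj (U₀ x κ) (s (Sum.inl (x + e κ))) - s (Sum.inl x)) :=
  Iff.rfl

/-- The λ-space is CLOSED in the sup norm (each defining equation compares continuous functions of `s`:
evaluations and a conjugation). [cite: Balaban1985RegularSpaces, (1.119) p.96] -/
theorem isClosed_lamSub (U₀ : Site d → Fin d → 𝔸ˣ) (w : ℝ) :
    IsClosed ((lamSub U₀ w : Submodule ℂ (PSpace d 𝔸)) : Set (PSpace d 𝔸)) := by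
  have : ((lamSub U₀ w : Submodule ℂ (PSpace d 𝔸)) : Set (PSpace d 𝔸)) =
      ⋂ (x : Site d), ⋂ (κ : Fin d), {s : PSpace d 𝔸 |
        s (Sum.inr (x, κ)) = (w : ℂ) • (cj (U₀ x κ) (s (Sum.inl (x + e κ))) - s (Sum.inl x))} := by
    ext s
    simp only [SetLike.mem_coe, mem_lamSub, Set.mem_iInter, Set.mem_setOf_eq]
  rw [this]
  refine isClosed_iInter fun x => isClosed_iInter fun κ => ?_
  refine isClosed_eq (ContinuousEvalConst.continuous_eval_const _) ?_
  have h1 : Continuous fun s : PSpace d 𝔸 => s (Sum.inl (x + e κ)) :=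
    ContinuousEvalConst.continuous_eval_const _
  have h2 : Continuous fun s : PSpace d 𝔸 => s (Sum.inl x) := ContinuousEvalConst.continuous_eval_const _
  have h3 : Continuous fun s : PSpace d 𝔸 => cj (U₀ x κ) (s (Sum.inl (x + e κ))) := by
    simp only [cj_apply]
    exact (continuous_const.mul h1).mul continuous_const
  exact (h3.sub h2).const_smul _

variable [CompleteSpace 𝔸]

/-- The λ-space is a Banach space. [cite: Balaban1985RegularSpaces, (1.119) p.96] -/
instance instCompleteSpaceLamSub (U₀ : Site d → Fin d → 𝔸ˣ) (w : ℝ) :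
    CompleteSpace (lamSub U₀ w : Submodule ℂ (PSpace d 𝔸)) :=
  (isClosed_lamSub U₀ w).completeSpace_coe

end Space

/-! ## §2 Reading a λ off the space, writing a λ into it, and the bounded `H′` -/

section Carrier

variable {𝔸 : Type*} [NormedRing 𝔸] [NormedAlgebra ℂ 𝔸]

/-- The λ-component of an element of the λ-space: `λ(x) = s(inl x)`. [cite: Balaban1985RegularSpaces, (1.119) p.96] -/
def lamOf {U₀ : Site d → Fin d → 𝔸ˣ} {w : ℝ} (s : lamSub U₀ w) : Site d → 𝔸 :=
  fun x => (s : PSpace d 𝔸) (Sum.inl x)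

/-- `lamOf` is additive-subtractive (it is the restriction of a linear map). [cite: Balaban1985RegularSpaces, (1.119) p.96] -/
theorem lamOf_sub {U₀ : Site d → Fin d → 𝔸ˣ} {w : ℝ} (s t : lamSub U₀ w) :
    lamOf (s - t) = lamOf s - lamOf t := by
  funext x
  simp [lamOf]

/-- `lamOf` commutes with addition. [cite: Balaban1985RegularSpaces, (1.119) p.96] -/
theorem lamOf_add {U₀ : Site d → Fin d → 𝔸ˣ} {w : ℝ} (s t : lamSub U₀ w) :
    lamOf (s + t) = lamOf s + lamOf t := by
  funext x
  simp [lamOf]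

/-- `lamOf` commutes with scalars. [cite: Balaban1985RegularSpaces, (1.119) p.96] -/
theorem lamOf_smul {U₀ : Site d → Fin d → 𝔸ˣ} {w : ℝ} (c : ℂ) (s : lamSub U₀ w) :
    lamOf (c • s) = c • lamOf s := by
  funext x
  simp [lamOf]

/-- **The |λ|-member of (1.119)/(1.120) from the norm**: `‖λ(x)‖ ≤ ‖s‖` for every site.
[cite: Balaban1985RegularSpaces, (1.119) p.96] -/
theorem norm_lamOf_le {U₀ : Site d → Fin d → 𝔸ˣ} {w : ℝ} (s : lamSub U₀ w) (x : Site d) :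
    ‖lamOf s x‖ ≤ ‖s‖ := by
  rw [Submodule.coe_norm]
  exact BoundedContinuousFunction.norm_coe_le_norm (s : PSpace d 𝔸) (Sum.inl x)

/-- **The |Dλ|-member of (1.119)/(1.120) from the norm**: `‖R(U₀(x,κ))λ(x + e_κ) − λ(x)‖ ≤ ‖s‖·w⁻¹` (weight
`w > 0`). [cite: Balaban1985RegularSpaces, (1.119) p.96] -/
theorem norm_cjDiff_lamOf_le {U₀ : Site d → Fin d → 𝔸ˣ} {w : ℝ} (hw : 0 < w) (s : lamSub U₀ w)
    (x : Site d) (κ : Fin d) :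
    ‖cj (U₀ x κ) (lamOf s (x + e κ)) - lamOf s x‖ ≤ ‖s‖ * w⁻¹ := by
  have hmem := (mem_lamSub.mp s.2) x κ
  have hle : ‖(s : PSpace d 𝔸) (Sum.inr (x, κ))‖ ≤ ‖s‖ := by
    rw [Submodule.coe_norm]
    exact BoundedContinuousFunction.norm_coe_le_norm (s : PSpace d 𝔸) (Sum.inr (x, κ))
  rw [hmem, norm_smul, Complex.norm_real, Real.norm_of_nonneg hw.le] at hle
  rw [le_mul_inv_iff₀ hw, mul_comm]
  exact hle

/-- The pair function `(λ, w·D_{U₀}λ)` of a λ. [cite: Balaban1985RegularSpaces, (1.119) p.96] -/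
def pairFun (U₀ : Site d → Fin d → 𝔸ˣ) (w : ℝ) (lam : Site d → 𝔸) : PairIdx d → 𝔸
  | Sum.inl x => lam x
  | Sum.inr (x, κ) => (w : ℂ) • (cj (U₀ x κ) (lam (x + e κ)) - lam x)

/-- The pair function is bounded by `max{sup|λ|, w·sup|Dλ|}`. [cite: Balaban1985RegularSpaces, (1.119) p.96] -/
theorem norm_pairFun_le {U₀ : Site d → Fin d → 𝔸ˣ} {w : ℝ} (hw : 0 ≤ w) {lam : Site d → 𝔸} {a b : ℝ}
    (ha : ∀ x, ‖lam x‖ ≤ a) (hb : ∀ x κ, ‖cj (U₀ x κ) (lam (x + e κ)) - lam x‖ ≤ b) (i : PairIdx d) :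
    ‖pairFun U₀ w lam i‖ ≤ max a (w * b) := by
  cases i with
  | inl x => exact (ha x).trans (le_max_left _ _)
  | inr p =>
    obtain ⟨x, κ⟩ := p
    simp only [pairFun]
    rw [norm_smul, Complex.norm_real, Real.norm_of_nonneg hw]
    exact (mul_le_mul_of_nonneg_left (hb x κ) hw).trans (le_max_right _ _)

/-- **Writing a λ with bounded modulus into the λ-space** (the element `(λ, w·D_{U₀}λ)`).
[cite: Balaban1985RegularSpaces, (1.119) p.96] -/
def mkLam (U₀ : Site d → Fin d → 𝔸ˣ) {w : ℝ} (hw : 0 ≤ w) (lam : Site d → 𝔸) {a b : ℝ}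
    (ha : ∀ x, ‖lam x‖ ≤ a) (hb : ∀ x κ, ‖cj (U₀ x κ) (lam (x + e κ)) - lam x‖ ≤ b) : lamSub U₀ w :=
  ⟨BoundedContinuousFunction.ofNormedAddCommGroupDiscrete (pairFun U₀ w lam) (max a (w * b))
      (norm_pairFun_le hw ha hb), by
    rw [mem_lamSub]
    intro x κ
    rfl⟩

/-- `lamOf (mkLam λ) = λ`. [cite: Balaban1985RegularSpaces, (1.119) p.96] -/
@[simp] theorem lamOf_mkLam (U₀ : Site d → Fin d → 𝔸ˣ) {w : ℝ} (hw : 0 ≤ w) (lam : Site d → 𝔸) {a b : ℝ}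
    (ha : ∀ x, ‖lam x‖ ≤ a) (hb : ∀ x κ, ‖cj (U₀ x κ) (lam (x + e κ)) - lam x‖ ≤ b) :
    lamOf (mkLam U₀ hw lam ha hb) = lam := by
  funext x
  rfl

/-- `‖mkLam λ‖ ≤ max{a, w·b}`. [cite: Balaban1985RegularSpaces, (1.119) p.96] -/
theorem norm_mkLam_le (U₀ : Site d → Fin d → 𝔸ˣ) {w : ℝ} (hw : 0 ≤ w) (lam : Site d → 𝔸) {a b : ℝ}
    (h0 : 0 ≤ a) (ha : ∀ x, ‖lam x‖ ≤ a) (hb : ∀ x κ, ‖cj (U₀ x κ) (lam (x + e κ)) - lam x‖ ≤ b) :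
    ‖mkLam U₀ hw lam ha hb‖ ≤ max a (w * b) := by
  rw [Submodule.coe_norm]
  refine (BoundedContinuousFunction.norm_le (h0.trans (le_max_left _ _))).2 fun i => ?_
  exact norm_pairFun_le hw ha hb i

/-- An element of the λ-space is determined by its λ-component. [cite: Balaban1985RegularSpaces, (1.119) p.96] -/
theorem ext_of_lamOf {U₀ : Site d → Fin d → 𝔸ˣ} {w : ℝ} {s t : lamSub U₀ w} (h : lamOf s = lamOf t) : s = t := by
  apply Subtype.ext
  ext i
  cases i with
  | inl x => exact congrFun h x
  | inr p =>
    obtain ⟨x, κ⟩ := p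
    rw [(mem_lamSub.mp s.2) x κ, (mem_lamSub.mp t.2) x κ]
    have h1 := congrFun h (x + e κ)
    have h2 := congrFun h x
    simp only [lamOf] at h1 h2
    rw [h1, h2]

variable {k : ℕ}

/-- **The bounded `H′`** of p05's concrete Sect. E files (READING (b) of `B8Eq1117Concrete`: a `ℂ`-linear
`H′ : XSpace → (ℤᵈ → 𝔸)` with `‖(H′X)(x)‖ ≤ B′₀‖X‖` and `‖R(U₀(b))(H′X)(b₊) − (H′X)(b₋)‖ ≤ B′₀‖X‖·w⁻¹`) as a
CONTINUOUS linear map into the λ-space, `X ↦ (H′X, w·D_{U₀}H′X)`. [cite: Balaban1985RegularSpaces, (1.91)–(1.92) p.91; (1.120) p.96] -/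
def Hc (U₀ : Site d → Fin d → 𝔸ˣ) {w : ℝ} (hw : 0 < w) (H' : XSpace d k 𝔸 →ₗ[ℂ] (Site d → 𝔸)) {B₀' : ℝ}
    (hB : 0 ≤ B₀') (hH0 : ∀ (X : XSpace d k 𝔸) (x : Site d), ‖H' X x‖ ≤ B₀' * ‖X‖)
    (hH1 : ∀ (X : XSpace d k 𝔸) (x : Site d) (κ : Fin d), ‖cj (U₀ x κ) (H' X (x + e κ)) - H' X x‖ ≤ B₀' * ‖X‖ * w⁻¹) :
    XSpace d k 𝔸 →L[ℂ] lamSub U₀ w :=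
  LinearMap.mkContinuous
    { toFun := fun X => mkLam U₀ hw.le (H' X) (hH0 X) (hH1 X)
      map_add' := by
        intro X Y
        apply ext_of_lamOf
        rw [lamOf_add, lamOf_mkLam, lamOf_mkLam, lamOf_mkLam, map_add]
      map_smul' := by
        intro c X
        apply ext_of_lamOf
        rw [RingHom.id_apply, lamOf_smul, lamOf_mkLam, lamOf_mkLam, map_smul] }
    B₀' (by
      intro X
      simp only [LinearMap.coe_mk, AddHom.coe_mk]
      refine (norm_mkLam_le U₀ hw.le (H' X) (by positivity) (hH0 X) (hH1 X)).trans ?_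
      refine max_le le_rfl ?_
      rw [show w * (B₀' * ‖X‖ * w⁻¹) = B₀' * ‖X‖ by field_simp])

/-- `lamOf (H′c X) = H′X`. [cite: Balaban1985RegularSpaces, (1.91) p.91] -/
@[simp] theorem lamOf_Hc (U₀ : Site d → Fin d → 𝔸ˣ) {w : ℝ} (hw : 0 < w) (H' : XSpace d k 𝔸 →ₗ[ℂ] (Site d → 𝔸))
    {B₀' : ℝ} (hB : 0 ≤ B₀') (hH0 : ∀ (X : XSpace d k 𝔸) (x : Site d), ‖H' X x‖ ≤ B₀' * ‖X‖)
    (hH1 : ∀ (X : XSpace d k 𝔸) (x : Site d) (κ : Fin d), ‖cj (U₀ x κ) (H' X (x + e κ)) - H' X x‖ ≤ B₀' * ‖X‖ * w⁻¹)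
    (X : XSpace d k 𝔸) : lamOf (Hc U₀ hw H' hB hH0 hH1 X) = H' X := by
  simp [Hc]

/-- **‖H′‖ ≤ B′₀** in the norm of the λ-space — print's (1.92) in the form (1.119) ⇒ (1.120) uses it.
[cite: Balaban1985RegularSpaces, (1.92) p.91; (1.120) p.96] -/
theorem norm_Hc_le (U₀ : Site d → Fin d → 𝔸ˣ) {w : ℝ} (hw : 0 < w) (H' : XSpace d k 𝔸 →ₗ[ℂ] (Site d → 𝔸))
    {B₀' : ℝ} (hB : 0 ≤ B₀') (hH0 : ∀ (X : XSpace d k 𝔸) (x : Site d), ‖H' X x‖ ≤ B₀' * ‖X‖)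
    (hH1 : ∀ (X : XSpace d k 𝔸) (x : Site d) (κ : Fin d), ‖cj (U₀ x κ) (H' X (x + e κ)) - H' X x‖ ≤ B₀' * ‖X‖ * w⁻¹) :
    ‖Hc U₀ hw H' hB hH0 hH1‖ ≤ B₀' :=
  LinearMap.mkContinuous_norm_le _ hB _

end Carrier

/-! ## §3 The abstract Sect. E theorems ON THE CONCRETE LATTICE `C′`

Standing data and hypotheses = those of p05's `B8Eq1117Concrete.eq1117_existsUnique` (general (52) background `U₀`
with values in an averaging-closed group `G`, the (1.29)-normalised `u₁ ∈ Λ_k`, the one-level (207) smallness at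
`2α₄`, `H′` abstract with the modulus bounds of (1.92)/(1.120) type, and print's smallness with `C′₂ := 2·C2p d`),
the λ's ranging over the λ-space `lamSub U₀ (L^k)`. -/

section Concrete

variable {𝔸 : Type*} [NormedRing 𝔸] [NormOneClass 𝔸] [NormedAlgebra ℂ 𝔸] [CompleteSpace 𝔸]

variable {L : ℕ} {G : Subgroup 𝔸ˣ} {U₀ : Site d → Fin d → 𝔸ˣ} {k : ℕ} {u₁ : Site d → 𝔸ˣ}
  {α₀ α₃ α₄ B₀' : ℝ} {H' : XSpace d k 𝔸 →ₗ[ℂ] (Site d → 𝔸)}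

/-- The weight `w = L^k` is positive for `2 ≤ L`. [folklore] -/
private theorem wpos (hL : 2 ≤ L) : (0 : ℝ) < (L : ℝ) ^ k := by positivity

/-- **The concrete `C′` on the λ-space**: `s ↦ (C′_j(u₁, λ_s)(z))_{j ≤ k, z}` = p05's packaged remainder `CnlF` at the
λ-component. [cite: Balaban1985RegularSpaces, (1.117)–(1.118) p.96; Balaban1985Averaging, (213) p.50] -/
def Cc (L : ℕ) (U₀ : Site d → Fin d → 𝔸ˣ) (u₁ : Site d → 𝔸ˣ) (k : ℕ) (s : lamSub U₀ ((L : ℝ) ^ k)) : XSpace d k 𝔸 :=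
  CnlF L U₀ u₁ k (lamOf s)

omit [NormOneClass 𝔸] in
/-- **(1.117) on the λ-space IS (1.118)'s fixed-point equation for p05's `fpMap`**: for `s` in the λ-space and the
bounded `H′`, `Eq1117 C′ H′ s X ↔ fpMap … (λ_s) X = X`. [cite: Balaban1985RegularSpaces, (1.117)–(1.118) p.96] -/
theorem eq1117_iff_fpMap (hL : 2 ≤ L) (hB : 0 ≤ B₀')
    (hH0 : ∀ (X : XSpace d k 𝔸) (x : Site d), ‖H' X x‖ ≤ B₀' * ‖X‖)
    (hH1 : ∀ (X : XSpace d k 𝔸) (x : Site d) (κ : Fin d),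
      ‖cj (U₀ x κ) (H' X (x + e κ)) - H' X x‖ ≤ B₀' * ‖X‖ * ((L : ℝ) ^ k)⁻¹)
    (s : lamSub U₀ ((L : ℝ) ^ k)) (X : XSpace d k 𝔸) :
    B8SectEStatements.Eq1117 (Cc L U₀ u₁ k) ((Hc U₀ (wpos hL) H' hB hH0 hH1).restrictScalars ℝ) s X ↔
      fpMap L U₀ u₁ k H' (lamOf s) X = X := by
  unfold B8SectEStatements.Eq1117 Cc fpMap
  rw [ContinuousLinearMap.coe_restrictScalars', lamOf_sub, lamOf_Hc]

omit [NormOneClass 𝔸] [CompleteSpace 𝔸] in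
/-- The norm ball `‖s‖ < a` of the λ-space gives the sitewise members of (1.119)/(1.120): `‖λ(x)‖ < a` and
`‖R(U₀(b))λ(b₊) − λ(b₋)‖ < a·L⁻ᵏ`. [cite: Balaban1985RegularSpaces, (1.119)–(1.120) p.96] -/
theorem sitewise_of_norm_lt (hL : 2 ≤ L) {s : lamSub U₀ ((L : ℝ) ^ k)} {a : ℝ} (hs : ‖s‖ < a) :
    (∀ (x : Site d) (κ : Fin d), ‖cj (U₀ x κ) (lamOf s (x + e κ)) - lamOf s x‖ < a * ((L : ℝ) ^ k)⁻¹) ∧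
      ∀ x : Site d, ‖lamOf s x‖ < a := by
  refine ⟨fun x κ => ?_, fun x => (norm_lamOf_le s x).trans_lt hs⟩
  have h := norm_cjDiff_lamOf_le (wpos hL) s x κ
  exact h.trans_lt (mul_lt_mul_of_pos_right hs (inv_pos.mpr (wpos hL)))

/-- The one-level (207)-hypotheses at `α₄` from those at `2α₄` (as in p05's proof). [folklore] -/
private theorem smallness_at_alpha4 {L : ℕ} {α₀ α₃ α₄ : ℝ} (hα₄ : 0 < α₄)
    (hs₁ : 200 * C6 d * (2 * α₄) ≤ 1) (hs₂ : 12000 * ((d : ℝ) + 1) * L * (2 * α₄) ≤ 1)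
    (hs₃ : C4G d L * (α₀ + α₃ + 4 * (2 * α₄)) ≤ 1) :
    200 * C6 d * α₄ ≤ 1 ∧ 12000 * ((d : ℝ) + 1) * L * α₄ ≤ 1 ∧ C4G d L * (α₀ + α₃ + 4 * α₄) ≤ 1 := by
  have hC4G : 0 ≤ C4G d L := by
    have h6 : (0 : ℝ) ≤ C6 d := by unfold C6; linarith [one_le_C5 (d := d)]
    have h7 : (0 : ℝ) ≤ C7 d := by unfold C7 C6; linarith [one_le_C5 (d := d), C5'_nonneg (d := d)]
    have h4' := C4'_nonneg (d := d)
    unfold C4G; positivity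
  refine ⟨?_, ?_, ?_⟩
  · have : (0 : ℝ) ≤ C6 d := by unfold C6; linarith [one_le_C5 (d := d)]
    nlinarith
  · have : (0 : ℝ) ≤ 12000 * ((d : ℝ) + 1) * L := by positivity
    nlinarith
  · nlinarith

section Standing

variable (hL : 2 ≤ L) (hG : AvgClosed d L G) (hU : ∀ x κ, U₀ x κ ∈ G)
  (hα : 0 < α₀) (hα3 : C0 d * α₀ ≤ 1 / 3) (hα2 : 2 * α₀ ≤ c2' d L)
  (h52 : pdev U₀ < α₀ * (((L : ℝ) ^ k)⁻¹) ^ 2)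
  (hB : 0 < B₀')
  (hH0 : ∀ (X : XSpace d k 𝔸) (x : Site d), ‖H' X x‖ ≤ B₀' * ‖X‖)
  (hH1 : ∀ (X : XSpace d k 𝔸) (x : Site d) (κ : Fin d),
    ‖cj (U₀ x κ) (H' X (x + e κ)) - H' X x‖ ≤ B₀' * ‖X‖ * ((L : ℝ) ^ k)⁻¹)
  (hu₁ : InLambda L U₀ u₁ k α₃ (((L : ℝ) ^ k)⁻¹))
  (hα₃ : 0 ≤ α₃) (hα₃' : α₃ ≤ 1 / 200) (hα₄ : 0 < α₄)
  (hs₁ : 200 * C6 d * (2 * α₄) ≤ 1) (hs₂ : 12000 * ((d : ℝ) + 1) * L * (2 * α₄) ≤ 1)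
  (hs₃ : C4G d L * (α₀ + α₃ + 4 * (2 * α₄)) ≤ 1)
  (hs₄ : 1024 * ((d : ℝ) + 1) * ((d : ℝ) + 4) * L ^ 2 * α₀ ≤ 1) (hs₅ : 32 * ((d : ℝ) + 1) ^ 2 * C6 d * L ^ 2 * α₀ ≤ 1)
  (hs₆ : 16 * d * C5' d * C6 d * (L : ℝ) ^ 2 * α₀ ≤ 1) (hs₇ : 8 * d * C6 d * L * α₀ ≤ 1)

include hL hG hU hα hα3 hα2 h52 hu₁ hα₃ hα₃' hα₄ hs₁ hs₂ hs₃ hs₄ hs₅ hs₆ hs₇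

/-- **(1.121) on the ball `‖μ‖ < α₄` of the λ-space**, sitewise form: `‖C′_j(u₁, λ_μ)(z)‖ ≤ C2p(α₃ + α₄)α₄` for all
`j ≤ k`, `z` (p05's `norm_Cnl_le_of207` = (214) of [3]). [cite: Balaban1985RegularSpaces, (1.121) p.96; Balaban1985Averaging, (214) p.50] -/
theorem norm_Cnl_lamOf_le {μ : lamSub U₀ ((L : ℝ) ^ k)} (hμ : ‖μ‖ < α₄) :
    ∀ j ≤ k, ∀ z : Site d, ‖B8Eq1123Concrete.Cnl L U₀ u₁ j (lamOf μ) z‖ ≤ C2p d * (α₃ + α₄) * α₄ := by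
  obtain ⟨h1, h2, h3⟩ := smallness_at_alpha4 (d := d) hα₄ hs₁ hs₂ hs₃
  obtain ⟨ha, hb⟩ := sitewise_of_norm_lt (U₀ := U₀) hL hμ
  exact norm_Cnl_le_of207 hL hG hU hα hα3 hα2 h52 ha hb hu₁ hα₃ hα₃' h1 h2 h3 hs₄ hs₅ hs₆ hs₇

/-- On the ball `‖μ‖ < α₄` the packaged `C′(μ)` evaluates to the genuine family.
[cite: Balaban1985RegularSpaces, (1.117) p.96; (1.121) p.96] -/
theorem Cc_apply {μ : lamSub U₀ ((L : ℝ) ^ k)} (hμ : ‖μ‖ < α₄) (p : Fin (k + 1) × Site d) :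
    Cc L U₀ u₁ k μ p = B8Eq1123Concrete.Cnl L U₀ u₁ p.1 (lamOf μ) p.2 := by
  have hbdd : ∃ C : ℝ, ∀ p : Fin (k + 1) × Site d, ‖B8Eq1123Concrete.Cnl L U₀ u₁ p.1 (lamOf μ) p.2‖ ≤ C :=
    ⟨C2p d * (α₃ + α₄) * α₄, fun p => norm_Cnl_lamOf_le hL hG hU hα hα3 hα2 h52 hu₁ hα₃ hα₃' hα₄ hs₁ hs₂ hs₃ hs₄
      hs₅ hs₆ hs₇ hμ p.1 (Nat.le_of_lt_succ p.1.isLt) p.2⟩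
  exact CnlF_apply hbdd p

/-- **(1.121) in the norm of the X-space, on the ball `‖μ‖ < α₄`, with the doubled constant `C′₂ := 2·C2p d`**
(the strict form the abstract `B8SectEStatements.eq1117_existsUnique` takes; strict because `C2p(α₃+α₄)α₄ > 0`).
[cite: Balaban1985RegularSpaces, (1.121) p.96; Balaban1985Averaging, (214) p.50] -/
theorem h121_concrete :
    ∀ μ : lamSub U₀ ((L : ℝ) ^ k), ‖μ‖ < α₄ → ‖Cc L U₀ u₁ k μ‖ < 2 * C2p d * (α₃ + α₄) * α₄ := by
  intro μ hμ
  have hC2pos : 0 < C2p d := by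
    have hC6 : (2 : ℝ) ≤ C6 d := by unfold C6; linarith [one_le_C5 (d := d)]
    unfold C2p B7Eq214General.Cgen; positivity
  have hpos : 0 < C2p d * (α₃ + α₄) * α₄ := by positivity
  have hle : ‖Cc L U₀ u₁ k μ‖ ≤ C2p d * (α₃ + α₄) * α₄ := by
    refine (BoundedContinuousFunction.norm_le hpos.le).2 fun p => ?_
    rw [Cc_apply hL hG hU hα hα3 hα2 h52 hu₁ hα₃ hα₃' hα₄ hs₁ hs₂ hs₃ hs₄ hs₅ hs₆ hs₇ hμ p]
    exact norm_Cnl_lamOf_le hL hG hU hα hα3 hα2 h52 hu₁ hα₃ hα₃' hα₄ hs₁ hs₂ hs₃ hs₄ hs₅ hs₆ hs₇ hμ p.1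
      (Nat.le_of_lt_succ p.1.isLt) p.2
  linarith

/-- **(1.125) on the ball `‖μ‖ < α₄` of the λ-space**: `‖C′(μ₁) − C′(μ₂)‖ ≤ 2·(2C2p)(α₃ + α₄)‖μ₁ − μ₂‖` — p05's
`lipschitz1122` at `2α₄` (G-B8-17: (1.125) is needed on the FULL-size set (1.120)) with modulus `m = ‖μ₁ − μ₂‖` =
print's `max{|λ₀|, |Dλ₀|}`, and `2C2p(α₃ + 2α₄) ≤ 4C2p(α₃ + α₄)`. [cite: Balaban1985RegularSpaces, (1.122)–(1.125) pp.96–97] -/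
theorem h125_concrete :
    ∀ μ₁ μ₂ : lamSub U₀ ((L : ℝ) ^ k), ‖μ₁‖ < α₄ → ‖μ₂‖ < α₄ →
      ‖Cc L U₀ u₁ k μ₁ - Cc L U₀ u₁ k μ₂‖ ≤ 2 * (2 * C2p d) * (α₃ + α₄) * ‖μ₁ - μ₂‖ := by
  intro μ₁ μ₂ hμ₁ hμ₂
  have hw := wpos (k := k) hL
  obtain ⟨h₁a, h₁b⟩ := sitewise_of_norm_lt (U₀ := U₀) hL hμ₁
  obtain ⟨h₂a, h₂b⟩ := sitewise_of_norm_lt (U₀ := U₀) hL hμ₂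
  have h2 : 2 * α₄ / 2 = α₄ := by ring
  have h₁a' : ∀ (x : Site d) (κ : Fin d),
      ‖cj (U₀ x κ) (lamOf μ₁ (x + e κ)) - lamOf μ₁ x‖ < 2 * α₄ / 2 * ((L : ℝ) ^ k)⁻¹ := by rw [h2]; exact h₁a
  have h₂a' : ∀ (x : Site d) (κ : Fin d),
      ‖cj (U₀ x κ) (lamOf μ₂ (x + e κ)) - lamOf μ₂ x‖ < 2 * α₄ / 2 * ((L : ℝ) ^ k)⁻¹ := by rw [h2]; exact h₂a
  have h₁b' : ∀ x : Site d, ‖lamOf μ₁ x‖ < 2 * α₄ / 2 := by rw [h2]; exact h₁b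
  have h₂b' : ∀ x : Site d, ‖lamOf μ₂ x‖ < 2 * α₄ / 2 := by rw [h2]; exact h₂b
  -- the modulus of the difference: m = ‖μ₁ − μ₂‖
  have hma : ∀ (x : Site d) (κ : Fin d),
      ‖cj (U₀ x κ) ((lamOf μ₁ - lamOf μ₂) (x + e κ)) - (lamOf μ₁ - lamOf μ₂) x‖ ≤ ‖μ₁ - μ₂‖ * ((L : ℝ) ^ k)⁻¹ := by
    intro x κ
    rw [← lamOf_sub]
    exact norm_cjDiff_lamOf_le hw (μ₁ - μ₂) x κ
  have hmb : ∀ x : Site d, ‖(lamOf μ₁ - lamOf μ₂) x‖ ≤ ‖μ₁ - μ₂‖ := by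
    intro x
    rw [← lamOf_sub]
    exact norm_lamOf_le (μ₁ - μ₂) x
  have hlip := lipschitz1122 hL hG hU (lamOf μ₁) (lamOf μ₂) hα hα3 hα2 h52 h₁a' h₁b' h₂a' h₂b' hma hmb hu₁ hα₃ hα₃'
    hs₁ hs₂ hs₃ hs₄ hs₅ hs₆ hs₇
  have hC2 : 0 ≤ C2p d := C2p_nonneg d
  have hm := norm_nonneg (μ₁ - μ₂)
  have h0 : 0 ≤ 2 * (2 * C2p d) * (α₃ + α₄) * ‖μ₁ - μ₂‖ := by positivity
  refine (BoundedContinuousFunction.norm_le h0).2 fun p => ?_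
  have hLr : (1 : ℝ) ≤ L := by exact_mod_cast le_trans (by norm_num) hL
  have ht : (L : ℝ) ^ (p.1 : ℕ) * ((L : ℝ) ^ k)⁻¹ ≤ 1 := by
    rw [← div_eq_mul_inv, div_le_one (by positivity)]
    exact pow_le_pow_right₀ hLr (Nat.le_of_lt_succ p.1.isLt)
  rw [BoundedContinuousFunction.coe_sub, Pi.sub_apply,
    Cc_apply hL hG hU hα hα3 hα2 h52 hu₁ hα₃ hα₃' hα₄ hs₁ hs₂ hs₃ hs₄ hs₅ hs₆ hs₇ hμ₁ p,
    Cc_apply hL hG hU hα hα3 hα2 h52 hu₁ hα₃ hα₃' hα₄ hs₁ hs₂ hs₃ hs₄ hs₅ hs₆ hs₇ hμ₂ p]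
  have h := hlip p.1 (Nat.le_of_lt_succ p.1.isLt) p.2
  have h0' : 0 ≤ C2p d * (2 * ‖μ₁ - μ₂‖) * (α₃ + 2 * α₄) := by positivity
  calc _ ≤ _ := h
    _ ≤ C2p d * (2 * ‖μ₁ - μ₂‖) * (α₃ + 2 * α₄) * 1 := mul_le_mul_of_nonneg_left ht h0'
    _ ≤ 2 * (2 * C2p d) * (α₃ + α₄) * ‖μ₁ - μ₂‖ := by
        rw [mul_one]
        nlinarith [mul_nonneg hC2 hm, mul_nonneg (mul_nonneg hC2 hm) hα₃]

include hB hH0 hH1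

/-- **«exactly one solution of Eq. (1.117)» on the λ-space, for the concrete lattice `C′`** — the abstract
`B8SectEStatements.eq1117_existsUnique` (E-B8-14) INSTANTIATED: `Λ` = the λ-space of (1.119) (norm = print's
modulus), `F` = p05's X-space, `C′` = `CnlF ∘ lamOf`, `H′` = the bounded `H′`; print's smallness with `C′₂ := 2·C2p d`
(G-B8-17). [cite: Balaban1985RegularSpaces, (1.117)–(1.121) pp.96–97, p.97 («exactly one solution of Eq. (1.117)»)] -/
theorem eq1117_existsUnique_lamSub (hsm : α₃ + α₄ ≤ 1 / (4 * B₀' * (2 * C2p d)))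
    {s : lamSub U₀ ((L : ℝ) ^ k)} (hs : ‖s‖ < α₄ / 2) :
    ∃! X : XSpace d k 𝔸, ‖X‖ ≤ α₄ / (2 * B₀') ∧
      B8SectEStatements.Eq1117 (Cc L U₀ u₁ k) ((Hc U₀ (wpos hL) H' hB.le hH0 hH1).restrictScalars ℝ) s X := by
  have hC2pos : 0 < 2 * C2p d := by
    have hC6 : (2 : ℝ) ≤ C6 d := by unfold C6; linarith [one_le_C5 (d := d)]
    unfold C2p B7Eq214General.Cgen; positivity
  have hHn : ‖(Hc U₀ (wpos hL) H' hB.le hH0 hH1).restrictScalars ℝ‖ ≤ B₀' := by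
    rw [ContinuousLinearMap.norm_restrictScalars]; exact norm_Hc_le U₀ (wpos hL) H' hB.le hH0 hH1
  exact B8SectEStatements.eq1117_existsUnique _ _ hB hC2pos hα₃ hα₄ hHn
    (h121_concrete hL hG hU hα hα3 hα2 h52 hu₁ hα₃ hα₃' hα₄ hs₁ hs₂ hs₃ hs₄ hs₅ hs₆ hs₇)
    (h125_concrete hL hG hU hα hα3 hα2 h52 hu₁ hα₃ hα₃' hα₄ hs₁ hs₂ hs₃ hs₄ hs₅ hs₆ hs₇) hsm hs

/-- **The abstract `D′` (E-B8-14 `B8SectEStatements.Dprime`) on the λ-space IS p05's concrete `D′`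
(`B8Eq1113Concrete.Dprime`) at the λ-component** — both are «the» solution of (1.117) in the ball `‖X‖ ≤ α₄/(2B′₀)`
(«exactly one solution … We take D′(λ) equal to this solution», p. 97).
[cite: Balaban1985RegularSpaces, (1.117) p.96; p.97 (definition of D′)] -/
theorem Dprime_lamSub_eq_concrete (hsm : α₃ + α₄ ≤ 1 / (4 * B₀' * (2 * C2p d)))
    {s : lamSub U₀ ((L : ℝ) ^ k)} (hs : ‖s‖ < α₄ / 2) :
    B8SectEStatements.Dprime (Cc L U₀ u₁ k) ((Hc U₀ (wpos hL) H' hB.le hH0 hH1).restrictScalars ℝ)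
        (α₄ / (2 * B₀')) s =
      B8Eq1113Concrete.Dprime L U₀ u₁ k H' (α₄ / (2 * B₀')) (lamOf s) := by
  have hC2pos : 0 < 2 * C2p d := by
    have hC6 : (2 : ℝ) ≤ C6 d := by unfold C6; linarith [one_le_C5 (d := d)]
    unfold C2p B7Eq214General.Cgen; positivity
  have hHn : ‖(Hc U₀ (wpos hL) H' hB.le hH0 hH1).restrictScalars ℝ‖ ≤ B₀' := by
    rw [ContinuousLinearMap.norm_restrictScalars]; exact norm_Hc_le U₀ (wpos hL) H' hB.le hH0 hH1
  obtain ⟨h119a, h119b⟩ := sitewise_of_norm_lt (U₀ := U₀) hL hs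
  -- p05's concrete D′ solves (1.118) in the ball
  obtain ⟨⟨hball, hfix⟩, -⟩ := B8Eq1113Concrete.Dprime_spec hL hG hU H' (lamOf s) hα hα3 hα2 h52 hB hH0 hH1 h119a
    h119b hu₁ hα₃ hα₃' hs₁ hs₂ hs₃ hs₄ hs₅ hs₆ hs₇ hsm
  -- hence it is the abstract D′ («exactly one solution»)
  have hsol : B8SectEStatements.Eq1117 (Cc L U₀ u₁ k) ((Hc U₀ (wpos hL) H' hB.le hH0 hH1).restrictScalars ℝ) s
      (B8Eq1113Concrete.Dprime L U₀ u₁ k H' (α₄ / (2 * B₀')) (lamOf s)) :=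
    (eq1117_iff_fpMap hL hB.le hH0 hH1 s _).mpr hfix
  exact (B8SectEStatements.Dprime_unique _ _ hB hC2pos hα₃ hα₄ hHn
    (h121_concrete hL hG hU hα hα3 hα2 h52 hu₁ hα₃ hα₃' hα₄ hs₁ hs₂ hs₃ hs₄ hs₅ hs₆ hs₇)
    (h125_concrete hL hG hU hα hα3 hα2 h52 hu₁ hα₃ hα₃' hα₄ hs₁ hs₂ hs₃ hs₄ hs₅ hs₆ hs₇) hsm hs hball hsol).symm

/-- **THE p. 97 ONTO SENTENCE ON THE CONCRETE CARRIER** (SKELETON row B8.Claim@97; verbatim: *"They imply in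
particular that the mapping (1.113) transforms the set {λ: |λ| < ½α₄, |Dλ| < ½α₄(L^jη)⁻¹ on Ω_j} onto a set
containing {λ′: |λ′| < ¼α₄, |Dλ′| < ¼α₄(L^jη)⁻¹ on Ω_j} for α₃, α₄ sufficiently small."*) — for the CONCRETE
lattice remainder `C′ = C′_j(u₁, ·)` and p05's concrete `D′` (H′ abstract as in p05's files; one-level (207) form,
weight `L^k`): every `λ′` of the λ-space with modulus `‖λ′‖ < ¼α₄` is `λ − H′D′(λ)` for some `λ` with modulus
`‖λ‖ < ½α₄`; "sufficiently small" = `α₃ + α₄ ≤ 1/(8B′₀·(2C2p))`.  Proof: the abstract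
`B8Claim97OntoProof.linMap_onto_quarter'` (p242197, r05 g2) on the λ-space + `Dprime_lamSub_eq_concrete`.
[cite: Balaban1985RegularSpaces, p.97 (last paragraph of Sect. E); (1.113) p.95] -/
theorem onto_concrete (hsm : α₃ + α₄ ≤ 1 / (8 * B₀' * (2 * C2p d)))
    (μ : lamSub U₀ ((L : ℝ) ^ k)) (hμ : ‖μ‖ < α₄ / 4) :
    ∃ s : lamSub U₀ ((L : ℝ) ^ k), ‖s‖ < α₄ / 2 ∧
      lamOf s - H' (B8Eq1113Concrete.Dprime L U₀ u₁ k H' (α₄ / (2 * B₀')) (lamOf s)) = lamOf μ := by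
  have hC2pos : 0 < 2 * C2p d := by
    have hC6 : (2 : ℝ) ≤ C6 d := by unfold C6; linarith [one_le_C5 (d := d)]
    unfold C2p B7Eq214General.Cgen; positivity
  have hHn : ‖(Hc U₀ (wpos hL) H' hB.le hH0 hH1).restrictScalars ℝ‖ ≤ B₀' := by
    rw [ContinuousLinearMap.norm_restrictScalars]; exact norm_Hc_le U₀ (wpos hL) H' hB.le hH0 hH1
  have hsm4 : α₃ + α₄ ≤ 1 / (4 * B₀' * (2 * C2p d)) := B8Claim97OntoProof.smallness_quarter_of_eighth hB hC2pos hsm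
  obtain ⟨s, hs, hlin⟩ := B8Claim97OntoProof.linMap_onto_quarter' _ _ hB hC2pos hα₃ hα₄ hHn
    (h121_concrete hL hG hU hα hα3 hα2 h52 hu₁ hα₃ hα₃' hα₄ hs₁ hs₂ hs₃ hs₄ hs₅ hs₆ hs₇)
    (h125_concrete hL hG hU hα hα3 hα2 h52 hu₁ hα₃ hα₃' hα₄ hs₁ hs₂ hs₃ hs₄ hs₅ hs₆ hs₇) hsm μ hμ
  refine ⟨s, hs, ?_⟩
  have h := congrArg lamOf hlin
  rw [lamOf_sub, ContinuousLinearMap.coe_restrictScalars', lamOf_Hc,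
    Dprime_lamSub_eq_concrete hL hG hU hα hα3 hα2 h52 hB hH0 hH1 hu₁ hα₃ hα₃' hα₄ hs₁ hs₂ hs₃ hs₄ hs₅ hs₆ hs₇ hsm4 hs] at h
  exact h

/-- The same sentence in λ-terms with the sitewise sets of p05's files: for `λ′ = λ_μ` with modulus `< ¼α₄` there is `λ`
in the half-size set (1.119) (`‖R(U₀(b))λ(b₊) − λ(b₋)‖ < ½α₄L⁻ᵏ`, `‖λ(x)‖ < ½α₄`) with `λ − H′D′(λ) = λ′`.
[cite: Balaban1985RegularSpaces, p.97 (last paragraph of Sect. E); (1.119) p.96] -/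
theorem onto_concrete_sitewise (hsm : α₃ + α₄ ≤ 1 / (8 * B₀' * (2 * C2p d)))
    (μ : lamSub U₀ ((L : ℝ) ^ k)) (hμ : ‖μ‖ < α₄ / 4) :
    ∃ lam : Site d → 𝔸,
      (∀ (x : Site d) (κ : Fin d), ‖cj (U₀ x κ) (lam (x + e κ)) - lam x‖ < α₄ / 2 * ((L : ℝ) ^ k)⁻¹) ∧
      (∀ x : Site d, ‖lam x‖ < α₄ / 2) ∧
      lam - H' (B8Eq1113Concrete.Dprime L U₀ u₁ k H' (α₄ / (2 * B₀')) lam) = lamOf μ := by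
  obtain ⟨s, hs, hlin⟩ := onto_concrete hL hG hU hα hα3 hα2 h52 hB hH0 hH1 hu₁ hα₃ hα₃' hα₄ hs₁ hs₂ hs₃ hs₄ hs₅ hs₆
    hs₇ hsm μ hμ
  obtain ⟨ha, hb⟩ := sitewise_of_norm_lt (U₀ := U₀) hL hs
  exact ⟨lamOf s, ha, hb, hlin⟩

/-- **The concrete `D′` is Lipschitz in the modulus of (1.119)** (the step print does not write out; abstract
`B8Claim97OntoProof.Dprime_lipschitz`): with `c = 2·(2C2p)(α₃ + α₄)`,
`‖D′(λ₁) − D′(λ₂)‖ ≤ c/(1 − cB′₀)·‖λ₁ − λ₂‖` for moduli `< ½α₄`. [cite: Balaban1985RegularSpaces, (1.117)–(1.118) p.96; (1.125) p.97] -/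
theorem Dprime_concrete_lipschitz (hsm : α₃ + α₄ ≤ 1 / (8 * B₀' * (2 * C2p d)))
    {s₁ s₂ : lamSub U₀ ((L : ℝ) ^ k)} (h₁ : ‖s₁‖ < α₄ / 2) (h₂ : ‖s₂‖ < α₄ / 2) :
    ‖B8Eq1113Concrete.Dprime L U₀ u₁ k H' (α₄ / (2 * B₀')) (lamOf s₁) -
        B8Eq1113Concrete.Dprime L U₀ u₁ k H' (α₄ / (2 * B₀')) (lamOf s₂)‖ ≤
      (2 * (2 * C2p d) * (α₃ + α₄)) / (1 - 2 * (2 * C2p d) * (α₃ + α₄) * B₀') * ‖s₁ - s₂‖ := by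
  have hC2pos : 0 < 2 * C2p d := by
    have hC6 : (2 : ℝ) ≤ C6 d := by unfold C6; linarith [one_le_C5 (d := d)]
    unfold C2p B7Eq214General.Cgen; positivity
  have hHn : ‖(Hc U₀ (wpos hL) H' hB.le hH0 hH1).restrictScalars ℝ‖ ≤ B₀' := by
    rw [ContinuousLinearMap.norm_restrictScalars]; exact norm_Hc_le U₀ (wpos hL) H' hB.le hH0 hH1
  have hsm4 : α₃ + α₄ ≤ 1 / (4 * B₀' * (2 * C2p d)) := B8Claim97OntoProof.smallness_quarter_of_eighth hB hC2pos hsm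
  have h := B8Claim97OntoProof.Dprime_lipschitz _ _ hB hC2pos hα₃ hα₄ hHn
    (h121_concrete hL hG hU hα hα3 hα2 h52 hu₁ hα₃ hα₃' hα₄ hs₁ hs₂ hs₃ hs₄ hs₅ hs₆ hs₇)
    (h125_concrete hL hG hU hα hα3 hα2 h52 hu₁ hα₃ hα₃' hα₄ hs₁ hs₂ hs₃ hs₄ hs₅ hs₆ hs₇) hsm h₁ h₂
  rwa [Dprime_lamSub_eq_concrete hL hG hU hα hα3 hα2 h52 hB hH0 hH1 hu₁ hα₃ hα₃' hα₄ hs₁ hs₂ hs₃ hs₄ hs₅ hs₆ hs₇ hsm4 h₁,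
    Dprime_lamSub_eq_concrete hL hG hU hα hα3 hα2 h52 hB hH0 hH1 hu₁ hα₃ hα₃' hα₄ hs₁ hs₂ hs₃ hs₄ hs₅ hs₆ hs₇ hsm4 h₂]
    at h

/-- **«This solution is an analytic function of λ» for the concrete `D′` — CONDITIONAL** on the Banach-space
analyticity of the concrete `C′` on the λ-space (hypothesis `hA`; [3] (208) prints the analyticity of
`Q′_j(u₁, λ)` in λ, formalised so far only along lines/families — `B7Eq208Analytic`, `B8Eq1123Concrete.analyticAt_Cnl_family`
— not as a map of Banach spaces; HONEST SCOPE): then `s ↦ D′(λ_s)` is `ℂ`-analytic at every modulus `< ½α₄`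
(abstract `B8Eq1117Analytic.Dprime_analyticAt` + `Dprime_lamSub_eq_concrete`).
[cite: Balaban1985RegularSpaces, p.97 («This solution is an analytic function of λ»); Balaban1985Averaging, (208) p.50] -/
theorem Dprime_concrete_analyticAt_of_analytic (hsm : α₃ + α₄ ≤ 1 / (4 * B₀' * (2 * C2p d)))
    (hA : ∀ μ : lamSub U₀ ((L : ℝ) ^ k), ‖μ‖ < α₄ → AnalyticAt ℂ (Cc L U₀ u₁ k) μ)
    {s₀ : lamSub U₀ ((L : ℝ) ^ k)} (hs₀ : ‖s₀‖ < α₄ / 2) :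
    AnalyticAt ℂ (fun s : lamSub U₀ ((L : ℝ) ^ k) =>
      B8Eq1113Concrete.Dprime L U₀ u₁ k H' (α₄ / (2 * B₀')) (lamOf s)) s₀ := by
  have hC2pos : 0 < 2 * C2p d := by
    have hC6 : (2 : ℝ) ≤ C6 d := by unfold C6; linarith [one_le_C5 (d := d)]
    unfold C2p B7Eq214General.Cgen; positivity
  have hHn : ‖Hc U₀ (wpos hL) H' hB.le hH0 hH1‖ ≤ B₀' := norm_Hc_le U₀ (wpos hL) H' hB.le hH0 hH1
  have habs := B8Eq1117Analytic.Dprime_analyticAt (Cc L U₀ u₁ k) (Hc U₀ (wpos hL) H' hB.le hH0 hH1) hB hC2pos hα₃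
    hα₄ hHn (h121_concrete hL hG hU hα hα3 hα2 h52 hu₁ hα₃ hα₃' hα₄ hs₁ hs₂ hs₃ hs₄ hs₅ hs₆ hs₇)
    (h125_concrete hL hG hU hα hα3 hα2 h52 hu₁ hα₃ hα₃' hα₄ hs₁ hs₂ hs₃ hs₄ hs₅ hs₆ hs₇) hsm hA hs₀
  -- the two functions agree on the open half ball, a neighbourhood of s₀
  refine habs.congr ?_
  have hopen : IsOpen {s : lamSub U₀ ((L : ℝ) ^ k) | ‖s‖ < α₄ / 2} := isOpen_lt continuous_norm continuous_const
  filter_upwards [hopen.mem_nhds hs₀] with s hs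
  exact Dprime_lamSub_eq_concrete hL hG hU hα hα3 hα2 h52 hB hH0 hH1 hu₁ hα₃ hα₃' hα₄ hs₁ hs₂ hs₃ hs₄ hs₅ hs₆ hs₇ hsm hs

end Standing

end Concrete

end Literature.MathematicalPhysics.QuantumFieldTheory.Balaban1983to89.B8Eq1119LambdaSpace

end
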